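import Literature.AlgebraicGeometry.Resolution.ResidueNotPthPower
import Literature.AlgebraicGeometry.Resolution.RsopLocalization
import Literature.RingTheory.RegularLocalRing.QuotientDVR
import Mathlib.RingTheory.Localization.LocalizationLocalization
import HarnessLib

/-!
# Exponents of two clean `p`-th-root generators along two crossing divisors are proportional

Topic: `Literature/AlgebraicGeometry/Resolution` (Kummer bookkeeping for purely inseparable
extensions of degree `p` in characteristic `p`). Let `A` be a (regular) local ring with `s, t`
part of a regular system of parameters, fraction field `K` of characteristic `p`, `[L : K] = p`,
and let `y₁, y₂ ∈ L` be `p`-th roots of CLEAN radicands in the two parameters,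

  `y₁^p = E₁ s^{a₁} t^{b₁}`, `y₂^p = E₂ s^{a₂} t^{b₂}`  (`E₁, E₂ ∈ Aˣ`),

with `y₁ ∉ K` and `p ∤ a₁`. Then (`exists_modEq_pair_of_pth_roots`) there is `j < p` with

  `a₂ ≡ j a₁ (mod p)` and `b₂ ≡ j b₁ (mod p)`:

the exponent vectors are proportional modulo `p`, with ONE factor `j` for both divisors. (Along
each divisor separately this is the valuation lemma `exists_residue_pow_mul_eq_of_pth_roots` of
`PthRootGeneratorsValuation.lean`; the point is that the two factors agree.)

Proof. In the discrete valuation ring `R = A_{(s)}` (uniformizer `s`; `t`, `Eᵢ` units) the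
valuation lemma gives `j < p`, `a₂ = p m + j a₁` and the residue identity
`d̄^p Ē₂ t̄^{b₂} = c̄^p (Ē₁ t̄^{b₁})^j` in `κ(s) = Frac(A/(s))` with `d ∉ 𝔪_R`; clearing
denominators, `d₁^p E₂ t^{b₂} ≡ c₁^p E₁^j t^{j b₁} (mod s)` with `d₁ ∉ (s)`. In the domain
`A/(s)` the element `t̄` is prime (`A/(s,t)` is a domain), and comparing `t̄`-adic orders of both
sides gives `p δ + b₂ = p γ + j b₁`, whence `b₂ ≡ j b₁ (mod p)`.

## Sources

Folklore (cf. the hyperbolic/Kummer coverings of V. Cossart, O. Piltant, J. Algebra 320 (2008)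
[CossartPiltant2008]); regularity facts from H. Matsumura, *Commutative Ring Theory* (1986),
Thm. 11.2, 14.2, 14.3 [Matsumura1987]. Everything here is proved from Mathlib and the tree.

## Not here

More than two divisors (apply the statement pairwise with a fixed charged divisor), and the case
`p ∣ a₁, p ∣ b₁`.
-/

noncomputable section

open IsLocalRing Literature.RingTheory.RegularLocalRing

namespace Literature.AlgebraicGeometry.Resolution

universe u

-- adapted from `Literature.NumberTheory.DiophantineGeometry.AlgFunctionField.pow_mul_eq_pow_mul_cancel`
-- (`ArtinSchreierCurvePointCount.lean`; private copy to keep the imports of this file light)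
/-- If `π` is a prime element of a domain and `π ∤ x`, `π ∤ y`, then `π^a x = π^b y` forces
`a = b`. [folklore] -/
private theorem eq_of_pow_mul_eq_pow_mul' {R : Type*} [CommRing R] [IsDomain R] {π x y : R}
    (hπ : Prime π) (hx : ¬ π ∣ x) (hy : ¬ π ∣ y) {a b : ℕ} (h : π ^ a * x = π ^ b * y) : a = b :=
  (eq_and_dvd_sub_of_pow_succ_dvd_sub hπ hx hy (m := b) (by rw [h, sub_self]; exact dvd_zero _)).1

/-- The localisation of a local ring at the prime `(s)` of a member `s` of a part of a regular
system of parameters is a discrete valuation ring with uniformizer `s`. [cite: Matsumura1987, Thm. 11.2] -/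
theorem isDiscreteValuationRing_localization_span_of_isRsopPart {A : Type u} [CommRing A]
    [IsLocalRing A] [IsDomain A] {n : ℕ} {z : Fin n → A} (hz : IsRsopPart z) (i : Fin n)
    [(Ideal.span {z i}).IsPrime] :
    IsDiscreteValuationRing (Localization.AtPrime (Ideal.span {z i})) ∧
      maximalIdeal (Localization.AtPrime (Ideal.span {z i})) =
        Ideal.span {algebraMap A (Localization.AtPrime (Ideal.span {z i})) (z i)} := by
  set R := Localization.AtPrime (Ideal.span {z i}) with hR
  have hone : IsRsopPart ![z i] := by
    have h := hz.comp ![i] (fun a b _ => Subsingleton.elim a b)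
    have heq : z ∘ ![i] = ![z i] := by ext k; fin_cases k; rfl
    rwa [heq] at h
  have hloc : IsRsopPart (fun k => algebraMap A R (![z i] k)) :=
    hone.map_localization_atPrime (Ideal.span {z i}) (fun k => by fin_cases k; exact Ideal.subset_span rfl)
  have hrange : Set.range (fun k => algebraMap A R (![z i] k)) = {algebraMap A R (z i)} := by
    ext x
    simp only [Set.mem_range, Set.mem_singleton_iff]
    exact ⟨fun ⟨k, hk⟩ => by fin_cases k; exact hk.symm, fun h => ⟨0, h.symm⟩⟩
  have hmax : maximalIdeal R = Ideal.span {algebraMap A R (z i)} := by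
    rw [← IsLocalization.AtPrime.map_eq_maximalIdeal (Ideal.span {z i}) R, Ideal.map_span,
      Set.image_singleton]
  haveI := hloc.isRegularLocalRing
  have hdim : ringKrullDim R = 1 := by
    have h := hloc.ringKrullDim_quotient_add
    rw [hrange, ← hmax] at h
    haveI : IsField (R ⧸ maximalIdeal R) :=
      (Ideal.Quotient.maximal_ideal_iff_isField_quotient _).mp inferInstance
    rw [ringKrullDim_eq_zero_of_isField this, zero_add] at h
    exact_mod_cast h.symm
  exact ⟨isDiscreteValuationRing_of_ringKrullDim_eq_one (R := R) hdim, hmax⟩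

/-- **Proportionality of the exponents of two clean generators along two crossing divisors.**
Let `A` be a local ring, `z = (s, t)` part of a regular system of parameters of `A`, `K` the
fraction field of `A`, of characteristic `p` (prime), `[L : K] = p`, and `y₁, y₂ ∈ L` with
`y₁ ∉ K`, `y_k^p = E_k s^{a_k} t^{b_k}` for units `E_k` of `A` (`k = 1, 2`) and `p ∤ a₁`. Then
`a₂ ≡ j a₁` and `b₂ ≡ j b₁ (mod p)` for some `j < p`. [folklore] -/
theorem exists_modEq_pair_of_pth_roots {A K L : Type u} [CommRing A] [IsLocalRing A] [Field K]
    [Algebra A K] [IsFractionRing A K] [Field L] [Algebra K L] [Algebra A L] [IsScalarTower A K L]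
    {p : ℕ} (hp : p.Prime) [CharP K p] (hdeg : Module.finrank K L = p) {z : Fin 2 → A}
    (hz : IsRsopPart z) (E₁ E₂ : A) (hE₁ : IsUnit E₁) (hE₂ : IsUnit E₂) (a₁ b₁ a₂ b₂ : ℕ)
    (ha₁ : ¬ p ∣ a₁) (y₁ y₂ : L) (hy₁ : y₁ ∉ Set.range (algebraMap K L))
    (hyp₁ : y₁ ^ p = algebraMap A L (E₁ * z 0 ^ a₁ * z 1 ^ b₁))
    (hyp₂ : y₂ ^ p = algebraMap A L (E₂ * z 0 ^ a₂ * z 1 ^ b₂)) :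
    ∃ j : ℕ, j < p ∧ a₂ ≡ j * a₁ [MOD p] ∧ b₂ ≡ j * b₁ [MOD p] := by
  classical
  haveI := hz.isRegularLocalRing
  haveI := isDomain_of_isRegularLocalRing A
  have hz2 : IsRsopPart ![z 0, z 1] := by
    have heq : ![z 0, z 1] = z := by ext k; fin_cases k <;> rfl
    rwa [heq]
  have hsprime : Prime (z 0) := hz.prime 0
  set P : Ideal A := Ideal.span {z 0} with hP
  haveI hPp : P.IsPrime := (Ideal.span_singleton_prime hsprime.ne_zero).mpr hsprime
  have htP : z 1 ∉ P := by
    rw [hP, Ideal.mem_span_singleton]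
    exact hz.not_dvd (i := 0) (j := 1) (by decide)
  -- the discrete valuation ring `R = A_{(s)}`
  set R := Localization.AtPrime P with hR
  obtain ⟨hDVR, hmax⟩ := isDiscreteValuationRing_localization_span_of_isRsopPart hz 0
  haveI := hDVR
  set ϖ : R := algebraMap A R (z 0) with hϖ
  have hϖirr : Irreducible ϖ := (IsDiscreteValuationRing.irreducible_iff_uniformizer ϖ).mpr hmax
  -- `K` and `L` over `R`
  letI : Algebra R K := IsLocalization.localizationAlgebraOfSubmonoidLe R K P.primeCompl
    (nonZeroDivisors A) P.primeCompl_le_nonZeroDivisors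
  haveI : IsScalarTower A R K := IsLocalization.localization_isScalarTower_of_submonoid_le R K _ _ _
  haveI : IsFractionRing R K :=
    IsFractionRing.isFractionRing_of_isDomain_of_isLocalization P.primeCompl R K
  letI : Algebra R L := ((algebraMap K L).comp (algebraMap R K)).toAlgebra
  haveI : IsScalarTower R K L := IsScalarTower.of_algebraMap_eq fun _ => rfl
  have hARL : ∀ x : A, algebraMap R L (algebraMap A R x) = algebraMap A L x := by
    intro x
    rw [IsScalarTower.algebraMap_apply R K L, ← IsScalarTower.algebraMap_apply A R K,
      ← IsScalarTower.algebraMap_apply A K L]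
  -- the radicands in `R`: units times powers of `ϖ`
  have htu : IsUnit (algebraMap A R (z 1)) := (IsLocalization.AtPrime.isUnit_to_map_iff R P (z 1)).mpr htP
  have hu₁ : IsUnit (algebraMap A R E₁ * algebraMap A R (z 1) ^ b₁) := (hE₁.map _).mul (htu.pow _)
  have hu₂ : IsUnit (algebraMap A R E₂ * algebraMap A R (z 1) ^ b₂) := (hE₂.map _).mul (htu.pow _)
  have hyp₁' : y₁ ^ p = algebraMap R L (hu₁.unit * ϖ ^ a₁) := by
    rw [hyp₁, ← hARL, IsUnit.unit_spec]
    congr 1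
    simp only [map_mul, map_pow, hϖ]
    ring
  have hyp₂' : y₂ ^ p = algebraMap R L (hu₂.unit * ϖ ^ a₂) := by
    rw [hyp₂, ← hARL, IsUnit.unit_spec]
    congr 1
    simp only [map_mul, map_pow, hϖ]
    ring
  obtain ⟨j, m, c, d, hj, ha₂, hd, hres⟩ := exists_residue_pow_mul_eq_of_pth_roots hp hdeg hϖirr
    hu₁.unit hu₂.unit a₁ a₂ ha₁ y₁ y₂ hy₁ hyp₁' hyp₂'
  refine ⟨j, hj, ?_, ?_⟩
  · -- `a₂ = p m + j a₁`
    refine (Nat.modEq_iff_dvd).mpr ⟨-m, ?_⟩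
    push_cast
    linear_combination -ha₂
  · -- the residue identity, cleared of denominators, read in `A/(s)`
    rw [IsUnit.unit_spec, IsUnit.unit_spec] at hres
    have hmemR : d ^ p * (algebraMap A R E₂ * algebraMap A R (z 1) ^ b₂) -
        c ^ p * (algebraMap A R E₁ * algebraMap A R (z 1) ^ b₁) ^ j ∈ maximalIdeal R := by
      rw [← residue_eq_zero_iff]
      simp only [map_sub, map_mul, map_pow] at hres ⊢
      rw [hres, sub_self]
    obtain ⟨⟨c₀, σ⟩, hc⟩ := IsLocalization.mk'_surjective P.primeCompl c
    obtain ⟨⟨d₀, τ⟩, hdd⟩ := IsLocalization.mk'_surjective P.primeCompl d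
    simp only at hc hdd
    have hd₀ : d₀ ∉ P := by
      rw [← hdd] at hd
      exact fun h => hd ((IsLocalization.AtPrime.mk'_mem_maximal_iff R P d₀ τ).mpr h)
    set d₁ : A := (σ : A) * d₀ with hd₁
    set c₁ : A := (τ : A) * c₀ with hc₁
    have hd₁P : d₁ ∉ P := fun h => (hPp.mem_or_mem h).elim σ.2 hd₀
    have hd₁R : algebraMap A R d₁ = algebraMap A R σ * algebraMap A R τ * d := by
      rw [hd₁, map_mul, ← hdd, mul_assoc, IsLocalization.mk'_spec' R d₀ τ]
    have hc₁R : algebraMap A R c₁ = algebraMap A R σ * algebraMap A R τ * c := by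
      rw [hc₁, map_mul, ← IsLocalization.mk'_spec' R c₀ σ, hc]
      ring
    have hmemA : d₁ ^ p * (E₂ * z 1 ^ b₂) - c₁ ^ p * (E₁ * z 1 ^ b₁) ^ j ∈ P := by
      rw [← IsLocalization.AtPrime.to_map_mem_maximal_iff R P]
      have h1 : algebraMap A R (d₁ ^ p * (E₂ * z 1 ^ b₂) - c₁ ^ p * (E₁ * z 1 ^ b₁) ^ j) =
          (algebraMap A R σ * algebraMap A R τ) ^ p *
            (d ^ p * (algebraMap A R E₂ * algebraMap A R (z 1) ^ b₂) -
              c ^ p * (algebraMap A R E₁ * algebraMap A R (z 1) ^ b₁) ^ j) := by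
        simp only [map_sub, map_mul, map_pow, hd₁R, hc₁R]
        ring
      rw [h1]
      exact Ideal.mul_mem_left _ _ hmemR
    -- in `B = A/(s)`: `t̄` is prime
    haveI : IsDomain (A ⧸ P) := (Ideal.Quotient.isDomain_iff_prime P).mpr hPp
    set mk := Ideal.Quotient.mk P with hmk
    have hπ : Prime (mk (z 1)) := prime_mk_of_isRsopPart hz2
    have hE₁u : IsUnit (mk E₁) := hE₁.map mk
    have hE₂u : IsUnit (mk E₂) := hE₂.map mk
    have hrel : mk d₁ ^ p * (mk E₂ * mk (z 1) ^ b₂) = mk c₁ ^ p * (mk E₁ * mk (z 1) ^ b₁) ^ j := by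
      have h1 : mk (d₁ ^ p * (E₂ * z 1 ^ b₂) - c₁ ^ p * (E₁ * z 1 ^ b₁) ^ j) = 0 :=
        (Ideal.Quotient.eq_zero_iff_mem).mpr hmemA
      rw [map_sub, sub_eq_zero] at h1
      simpa only [map_mul, map_pow] using h1
    have hd₁0 : mk d₁ ≠ 0 := by rwa [Ne, Ideal.Quotient.eq_zero_iff_mem]
    obtain ⟨δ, d', hd', hdd'⟩ := WfDvdMonoid.max_power_factor' hd₁0 hπ.not_unit
    have hX : ¬ mk (z 1) ∣ d' ^ p * mk E₂ := by
      intro h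
      rcases hπ.dvd_or_dvd h with h | h
      · exact hd' (hπ.dvd_of_dvd_pow h)
      · exact hπ.not_unit (isUnit_of_dvd_unit h hE₂u)
    have hc₁0 : mk c₁ ≠ 0 := by
      intro h0
      rw [h0, zero_pow hp.ne_zero, zero_mul, hdd'] at hrel
      have h1 : mk (z 1) ^ (p * δ + b₂) * (d' ^ p * mk E₂) = 0 := by rw [← hrel]; ring
      rcases mul_eq_zero.mp h1 with h2 | h2
      · exact pow_ne_zero _ hπ.ne_zero h2
      · exact hX (h2 ▸ dvd_zero _)
    obtain ⟨γ, c', hc', hcc'⟩ := WfDvdMonoid.max_power_factor' hc₁0 hπ.not_unit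
    have hY : ¬ mk (z 1) ∣ c' ^ p * mk E₁ ^ j := by
      intro h
      rcases hπ.dvd_or_dvd h with h | h
      · exact hc' (hπ.dvd_of_dvd_pow h)
      · exact hπ.not_unit (isUnit_of_dvd_unit (hπ.dvd_of_dvd_pow h) hE₁u)
    have key : mk (z 1) ^ (p * δ + b₂) * (d' ^ p * mk E₂) =
        mk (z 1) ^ (p * γ + j * b₁) * (c' ^ p * mk E₁ ^ j) := by
      rw [hdd', hcc'] at hrel
      calc mk (z 1) ^ (p * δ + b₂) * (d' ^ p * mk E₂)
          = (mk (z 1) ^ δ * d') ^ p * (mk E₂ * mk (z 1) ^ b₂) := by ring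
        _ = (mk (z 1) ^ γ * c') ^ p * (mk E₁ * mk (z 1) ^ b₁) ^ j := hrel
        _ = mk (z 1) ^ (p * γ + j * b₁) * (c' ^ p * mk E₁ ^ j) := by ring
    have hexp : p * δ + b₂ = p * γ + j * b₁ := eq_of_pow_mul_eq_pow_mul' hπ hX hY key
    have h0 : p * δ ≡ p * γ [MOD p] :=
      (Nat.modEq_zero_iff_dvd.mpr (dvd_mul_right p δ)).trans
        (Nat.modEq_zero_iff_dvd.mpr (dvd_mul_right p γ)).symm
    exact Nat.ModEq.add_left_cancel h0 (hexp ▸ Nat.ModEq.refl _)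

end Literature.AlgebraicGeometry.Resolution

end
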